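import Literature.Geometry.Lorentzian.ObstructionFreeGluing
import Literature.Geometry.Lorentzian.InitialDataDilation
import Mathlib.MeasureTheory.Measure.Haar.NormedSpace
import Mathlib.Analysis.Calculus.FDeriv.Equiv
import HarnessLib

/-!
# Scaling laws of the averaged charges (Mao–Oh–Tao 2023, §1.2)

Y. Mao, S.-J. Oh, Z. Tao, arXiv:2308.13031 [MaoOhTao2023], §1.2: the constraint equations are invariant under the scaling
`(g, k) ↦ (g^{(r)}, k^{(r)})(x) = (g(rx), r k(rx))` ((1.2)), and the averaged charges transform as (p. 5, top)

  `(E, P)[(g^{(r)}, k^{(r)}); A_{R₀}] = r⁻¹ (E, P)[(g, k); A_{rR₀}]`,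
  `(C, J)[(g^{(r)}, k^{(r)}); A_{R₀}] = r⁻² (C, J)[(g, k); A_{rR₀}]`.

This file proves the four laws for the tree's `MaoOhTao.avgE/avgP/avgC/avgJ` (`ObstructionFreeGluing.lean`), for every
`r > 0` and without any regularity or integrability hypothesis (the chain rule `fderiv_comp_smul` and the change of
variables `Measure.integral_comp_smul` both hold with Mathlib's junk-value conventions): `avgE_dilate`, `avgP_dilate`,
`avgC_dilate`, `avgJ_dilate`.  These are the laws by which the asymptotically flat gluing theorems (Thm 1.6, Thm 1.10)
are reduced to the unit-scale Theorems 1.3 and 1.7.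

Everything is proved; no definitions, no named facts.

## §3 The tree's dilation of data

For the dilation `C.dilate l hl` of `InitialDataDilation.lean` (`h'(y) = h(y/l)`, `k'(y) = l⁻¹ k(y/l)`,
i.e. the paper's `(g^{(r)}, k^{(r)})` with `r = l⁻¹`) the laws read
`(E, P)[C.dilate l; A_{R₀}] = l · (E, P)[C; A_{R₀/l}]` and `(C, J)[C.dilate l; A_{R₀}] = l² · (C, J)[C; A_{R₀/l}]`
(`avgE_coordH_dilate`, `avgP_coordK_dilate`, `avgC_coordH_dilate`, `avgJ_coordK_dilate`).

## References

* Y. Mao, S.-J. Oh, Z. Tao, arXiv:2308.13031 (2023), §1.2, (1.2), (1.7) and the display on p. 5. [MaoOhTao2023]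
-/

noncomputable section

namespace Literature.Geometry.Lorentzian

namespace MaoOhTao

open scoped _root_.Manifold _root_.ContDiff BigOperators _root_.Topology
open _root_.MeasureTheory _root_.Filter _root_.Set

variable {η : ℝ → ℝ} {R₀ ρ : ℝ} {g k : E3 → E3 →L[ℝ] E3 →L[ℝ] ℝ}

/-- The components of the rescaled metric coefficient field `g^{(ρ)}(x) = g(ρx)` ((1.2)). [cite: MaoOhTao2023, §1.2 (1.2)] -/
theorem cmp_dilate (g : E3 → E3 →L[ℝ] E3 →L[ℝ] ℝ) (ρ : ℝ) (i j : Fin 3) :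
    cmp (fun x ↦ g (ρ • x)) i j = fun x ↦ cmp g i j (ρ • x) := rfl

/-- Chain rule for the rescaled field: `∂_l (g_{ij}(ρx)) = ρ (∂_l g_{ij})(ρx)` — unconditionally, with the junk-value
convention of `fderiv` on both sides (`fderiv_comp_smul`). [folklore] -/
theorem pd_cmp_dilate (g : E3 → E3 →L[ℝ] E3 →L[ℝ] ℝ) (ρ : ℝ) (i j l : Fin 3) (x : E3) :
    pd l (cmp (fun x ↦ g (ρ • x)) i j) x = ρ * pd l (cmp g i j) (ρ • x) := by
  have h := fderiv_comp_smul (𝕜 := ℝ) (f := cmp g i j) (x := x) ρ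
  simp only [pd, cmp_dilate]
  rw [show (fun x : E3 ↦ cmp g i j (ρ • x)) = (cmp g i j <| ρ • ·) from rfl, h]
  simp [smul_eq_mul]

/-- `|ρx| = ρ|x|` for `ρ > 0`. [folklore] -/
theorem norm_dilate (hρ : 0 < ρ) (x : E3) : ‖ρ • x‖ = ρ * ‖x‖ := by
  rw [norm_smul, Real.norm_eq_abs, abs_of_pos hρ]

/-- The radial weights under dilation: `η_{R₀}(|x|) = ρ η_{ρR₀}(|ρx|)` for `ρ > 0`. [cite: MaoOhTao2023, §1.2 (1.7)] -/
theorem wt_dilate (η : ℝ → ℝ) (R₀ : ℝ) (hρ : 0 < ρ) (x : E3) :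
    wt η R₀ x = ρ * wt η (ρ * R₀) (ρ • x) := by
  simp only [wt, norm_dilate hρ, mul_inv_rev]
  rw [mul_div_mul_left _ _ hρ.ne']
  field_simp

/-- The unit radial vector is dilation invariant: `(ρx)^j/|ρx| = x^j/|x|` for `ρ > 0`. [folklore] -/
theorem unitVec_dilate (hρ : 0 < ρ) (x : E3) (j : Fin 3) :
    (ρ • x) j / ‖ρ • x‖ = x j / ‖x‖ := by
  rw [norm_dilate hρ, PiLp.smul_apply, smul_eq_mul, mul_div_mul_left _ _ hρ.ne']

/-- The change of variables `y = ρx` on `ℝ³`: `∫ Φ(ρx) dx = ρ⁻³ ∫ Φ` for `ρ > 0` (Mathlib's `Measure.integral_comp_smul`,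
valid without integrability). [folklore] -/
theorem integral_dilate (hρ : 0 < ρ) (Φ : E3 → ℝ) :
    ∫ x : E3, Φ (ρ • x) = (ρ ^ 3)⁻¹ * ∫ y : E3, Φ y := by
  rw [Measure.integral_comp_smul volume Φ ρ, finrank_euclideanSpace_fin, smul_eq_mul,
    abs_of_pos (inv_pos.2 (pow_pos hρ 3))]

/-- **Scaling law of the averaged energy** (Mao–Oh–Tao 2023, §1.2): under the invariant scaling
`g ↦ g^{(ρ)}(x) = g(ρx)` ((1.2)), `E[g^{(ρ)}; A_{R₀}] = ρ⁻¹ E[g; A_{ρR₀}]`. [cite: MaoOhTao2023, §1.2] -/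
theorem avgE_dilate (η : ℝ → ℝ) (R₀ : ℝ) (hρ : 0 < ρ) (g : E3 → E3 →L[ℝ] E3 →L[ℝ] ℝ) :
    avgE η R₀ (fun x ↦ g (ρ • x)) = ρ⁻¹ * avgE η (ρ * R₀) g := by
  unfold avgE
  set Φ : E3 → ℝ := fun y ↦ wt η (ρ * R₀) y *
    ∑ i, ∑ j, (pd i (cmp g i j) y - pd j (cmp g i i) y) * (y j / ‖y‖) with hΦ
  have hpt : ∀ x : E3, wt η R₀ x * ∑ i, ∑ j,
      (pd i (cmp (fun x ↦ g (ρ • x)) i j) x - pd j (cmp (fun x ↦ g (ρ • x)) i i) x) * (x j / ‖x‖) =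
      ρ ^ 2 * Φ (ρ • x) := by
    intro x
    simp only [hΦ, pd_cmp_dilate, unitVec_dilate hρ, wt_dilate η R₀ hρ x, Finset.mul_sum]
    refine Finset.sum_congr rfl fun i _ ↦ Finset.sum_congr rfl fun j _ ↦ ?_
    ring
  simp_rw [hpt]
  rw [integral_const_mul, integral_dilate hρ Φ]
  field_simp

/-- The components of the rescaled second fundamental form `k^{(ρ)}(x) = ρ k(ρx)` ((1.2)).
[cite: MaoOhTao2023, §1.2 (1.2)] -/
theorem cmp_dilateK (k : E3 → E3 →L[ℝ] E3 →L[ℝ] ℝ) (ρ : ℝ) (i j : Fin 3) (x : E3) :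
    cmp (fun x ↦ ρ • k (ρ • x)) i j x = ρ * cmp k i j (ρ • x) := by
  simp [cmp]

/-- The Euclidean trace of the rescaled second fundamental form: `tr_δ k^{(ρ)}(x) = ρ (tr_δ k)(ρx)`.
[cite: MaoOhTao2023, §1.2 (1.2)] -/
theorem trδ_dilateK (k : E3 → E3 →L[ℝ] E3 →L[ℝ] ℝ) (ρ : ℝ) (x : E3) :
    trδ (fun x ↦ ρ • k (ρ • x)) x = ρ * trδ k (ρ • x) := by
  simp only [trδ, cmp_dilateK, Finset.mul_sum]

/-- The rotation fields are linear: `Y_l(ρx) = ρ Y_l(x)`. [cite: MaoOhTao2023, §1.1] -/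
theorem rotGen_dilate (l i : Fin 3) (ρ : ℝ) (x : E3) : rotGen l (ρ • x) i = ρ * rotGen l x i := by
  fin_cases i <;> simp [rotGen] <;> ring

/-- **Scaling law of the averaged linear momentum** (Mao–Oh–Tao 2023, §1.2): under the invariant scaling
`k ↦ k^{(ρ)}(x) = ρ k(ρx)` ((1.2)), `P_l[k^{(ρ)}; A_{R₀}] = ρ⁻¹ P_l[k; A_{ρR₀}]`. [cite: MaoOhTao2023, §1.2] -/
theorem avgP_dilate (η : ℝ → ℝ) (R₀ : ℝ) (hρ : 0 < ρ) (k : E3 → E3 →L[ℝ] E3 →L[ℝ] ℝ) (l : Fin 3) :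
    avgP η R₀ (fun x ↦ ρ • k (ρ • x)) l = ρ⁻¹ * avgP η (ρ * R₀) k l := by
  unfold avgP
  set Φ : E3 → ℝ := fun y ↦ wt η (ρ * R₀) y *
    ∑ j, (cmp k l j y - (if l = j then trδ k y else 0)) * (y j / ‖y‖) with hΦ
  have hpt : ∀ x : E3, wt η R₀ x * ∑ j, (cmp (fun x ↦ ρ • k (ρ • x)) l j x
      - (if l = j then trδ (fun x ↦ ρ • k (ρ • x)) x else 0)) * (x j / ‖x‖) = ρ ^ 2 * Φ (ρ • x) := by
    intro x
    simp only [hΦ, cmp_dilateK, trδ_dilateK, unitVec_dilate hρ, wt_dilate η R₀ hρ x, Finset.mul_sum]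
    refine Finset.sum_congr rfl fun j _ ↦ ?_
    split_ifs <;> ring
  simp_rw [hpt]
  rw [integral_const_mul, integral_dilate hρ Φ]
  field_simp

/-- **Scaling law of the averaged centre of mass** (Mao–Oh–Tao 2023, §1.2): `C_l[g^{(ρ)}; A_{R₀}] = ρ⁻² C_l[g; A_{ρR₀}]`.
[cite: MaoOhTao2023, §1.2] -/
theorem avgC_dilate (η : ℝ → ℝ) (R₀ : ℝ) (hρ : 0 < ρ) (g : E3 → E3 →L[ℝ] E3 →L[ℝ] ℝ) (l : Fin 3) :
    avgC η R₀ (fun x ↦ g (ρ • x)) l = (ρ ^ 2)⁻¹ * avgC η (ρ * R₀) g l := by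
  unfold avgC
  set Φ : E3 → ℝ := fun y ↦ wt η (ρ * R₀) y * ∑ i, ∑ j,
    (y l * pd i (cmp g i j) y - y l * pd j (cmp g i i) y
      - (if i = l then cmp g i j y - (if i = j then 1 else 0) else 0)
      + (if j = l then cmp g i i y - 1 else 0)) * (y j / ‖y‖) with hΦ
  have hpt : ∀ x : E3, wt η R₀ x * ∑ i, ∑ j,
      (x l * pd i (cmp (fun x ↦ g (ρ • x)) i j) x - x l * pd j (cmp (fun x ↦ g (ρ • x)) i i) x
        - (if i = l then cmp (fun x ↦ g (ρ • x)) i j x - (if i = j then 1 else 0) else 0)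
        + (if j = l then cmp (fun x ↦ g (ρ • x)) i i x - 1 else 0)) * (x j / ‖x‖) = ρ * Φ (ρ • x) := by
    intro x
    simp only [hΦ, pd_cmp_dilate, unitVec_dilate hρ, wt_dilate η R₀ hρ x]
    simp only [cmp_dilate, PiLp.smul_apply, smul_eq_mul, Finset.mul_sum]
    refine Finset.sum_congr rfl fun i _ ↦ Finset.sum_congr rfl fun j _ ↦ ?_
    split_ifs <;> ring
  simp_rw [hpt]
  rw [integral_const_mul, integral_dilate hρ Φ]
  field_simp

/-- **Scaling law of the averaged angular momentum** (Mao–Oh–Tao 2023, §1.2): `J_l[k^{(ρ)}; A_{R₀}] = ρ⁻² J_l[k; A_{ρR₀}]`.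
[cite: MaoOhTao2023, §1.2] -/
theorem avgJ_dilate (η : ℝ → ℝ) (R₀ : ℝ) (hρ : 0 < ρ) (k : E3 → E3 →L[ℝ] E3 →L[ℝ] ℝ) (l : Fin 3) :
    avgJ η R₀ (fun x ↦ ρ • k (ρ • x)) l = (ρ ^ 2)⁻¹ * avgJ η (ρ * R₀) k l := by
  unfold avgJ
  set Φ : E3 → ℝ := fun y ↦ wt η (ρ * R₀) y * ∑ i, ∑ j,
    (cmp k i j y - (if i = j then trδ k y else 0)) * rotGen l y i * (y j / ‖y‖) with hΦ
  have hpt : ∀ x : E3, wt η R₀ x * ∑ i, ∑ j, (cmp (fun x ↦ ρ • k (ρ • x)) i j x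
      - (if i = j then trδ (fun x ↦ ρ • k (ρ • x)) x else 0)) * rotGen l x i * (x j / ‖x‖) =
      ρ * Φ (ρ • x) := by
    intro x
    simp only [hΦ, cmp_dilateK, trδ_dilateK, unitVec_dilate hρ, wt_dilate η R₀ hρ x, rotGen_dilate,
      Finset.mul_sum]
    refine Finset.sum_congr rfl fun i _ ↦ Finset.sum_congr rfl fun j _ ↦ ?_
    split_ifs <;> ring
  simp_rw [hpt]
  rw [integral_const_mul, integral_dilate hρ Φ]
  field_simp

/-! ## §3 The averaged charges of the dilated data `InitialDataSet.dilate` -/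

section Dilate

open scoped _root_.Manifold

variable (C : InitialDataSet (𝓡 3) E3) {l : ℝ} (hl : 0 < l)
include hl

/-- **Energy of dilated data**: `E_η[(C.dilate l).h; A_{R₀}] = l · E_η[h; A_{R₀/l}]` (Mao–Oh–Tao (1.2) and the
scaling law of §1.2 with `r = l⁻¹`, for the tree's `InitialDataSet.dilate`; `coordH_dilate` and `avgE_dilate`).
[cite: MaoOhTao2023, §1.2, (1.2)] -/
theorem avgE_coordH_dilate (η : ℝ → ℝ) (R₀ : ℝ) :
    avgE η R₀ (C.dilate l hl).coordH = l * avgE η (R₀ / l) C.coordH := by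
  rw [show (C.dilate l hl).coordH = fun x ↦ C.coordH (l⁻¹ • x) from
      funext (InitialDataSet.coordH_dilate C l hl),
    avgE_dilate η R₀ (inv_pos.2 hl), inv_inv, inv_mul_eq_div]

/-- **Linear momentum of dilated data**: `P_η[(C.dilate l).k; A_{R₀}]_i = l · P_η[k; A_{R₀/l}]_i`
(`coordK_dilate` and `avgP_dilate`). [cite: MaoOhTao2023, §1.2, (1.2)] -/
theorem avgP_coordK_dilate (η : ℝ → ℝ) (R₀ : ℝ) (i : Fin 3) :
    avgP η R₀ (C.dilate l hl).coordK i = l * avgP η (R₀ / l) C.coordK i := by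
  rw [show (C.dilate l hl).coordK = fun x ↦ l⁻¹ • C.coordK (l⁻¹ • x) from
      funext (InitialDataSet.coordK_dilate C l hl),
    avgP_dilate η R₀ (inv_pos.2 hl), inv_inv, inv_mul_eq_div]

/-- **Centre of mass of dilated data**: `C_η[(C.dilate l).h; A_{R₀}]_i = l² · C_η[h; A_{R₀/l}]_i`
(`coordH_dilate` and `avgC_dilate`). [cite: MaoOhTao2023, §1.2, (1.2)] -/
theorem avgC_coordH_dilate (η : ℝ → ℝ) (R₀ : ℝ) (i : Fin 3) :
    avgC η R₀ (C.dilate l hl).coordH i = l ^ 2 * avgC η (R₀ / l) C.coordH i := by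
  rw [show (C.dilate l hl).coordH = fun x ↦ C.coordH (l⁻¹ • x) from
      funext (InitialDataSet.coordH_dilate C l hl),
    avgC_dilate η R₀ (inv_pos.2 hl), inv_pow, inv_inv, inv_mul_eq_div]

/-- **Angular momentum of dilated data**: `J_η[(C.dilate l).k; A_{R₀}]_i = l² · J_η[k; A_{R₀/l}]_i`
(`coordK_dilate` and `avgJ_dilate`). [cite: MaoOhTao2023, §1.2, (1.2)] -/
theorem avgJ_coordK_dilate (η : ℝ → ℝ) (R₀ : ℝ) (i : Fin 3) :
    avgJ η R₀ (C.dilate l hl).coordK i = l ^ 2 * avgJ η (R₀ / l) C.coordK i := by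
  rw [show (C.dilate l hl).coordK = fun x ↦ l⁻¹ • C.coordK (l⁻¹ • x) from
      funext (InitialDataSet.coordK_dilate C l hl),
    avgJ_dilate η R₀ (inv_pos.2 hl), inv_pow, inv_inv, inv_mul_eq_div]

end Dilate

end MaoOhTao

end Literature.Geometry.Lorentzian

end
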